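import Literature.Computability.QuantumComplexity.Forrelation

/-!
# Crux `CubicForrelation.SignedCubicForrelationNotPrBPP` (stmt-QuantumAdvantage-13931)

Stub `stub_coupledInvariance` of the line `Sketch` (K4, "coupled invariance").

The kernel-descent line changes coordinates on the second function (`b ↦ b ∘ e`, `e` a
bijection of `{0,1}ⁿ`) and compensates on the first (`a ↦ a ∘ e'`). If the pair `(e, e')` is
ADJOINT for the characters — `(-1)^{e'(u)·e(v)} = (-1)^{u·v}` for all `u v`, stated here as
`twist (e' u) (e v) = twist u v`, so no matrices are needed — then the coupled action preserves
the forrelation `Φ` EXACTLY, sign included: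

  `Φ(a ∘ e', b ∘ e) = Φ(a, b)`.

Proof (three lines on paper): the normalisation factors `2^{-3n/2}` agree; reindex the outer sum
by the bijection `e'` and the inner one by `e` (`Equiv.sum_comp`), which turns `Σ_x Σ_y
(-1)^{a x} (-1)^{x·y} (-1)^{b y}` into `Σ_x Σ_y (-1)^{a (e' x)} (-1)^{e'(x)·e(y)} (-1)^{b (e y)}`,
and rewrite `(-1)^{e'(x)·e(y)} = (-1)^{x·y}` by adjointness.

Also recorded (cheap corollaries useful to the line): the hypothesis is symmetric in the roles
of `e, e'` (`twist_comm`), whence the mirror statement `Φ(a ∘ e, b ∘ e') = Φ(a, b)`.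
-/

noncomputable section

set_option linter.dupNamespace false -- D-0017: single-problem summit ⇒ `QuantumAdvantage.QuantumAdvantage` by design

namespace Summit.QuantumAdvantage.QuantumAdvantage.Theorems.SignedCubicForrelationNotPrBPP

open Literature.Computability.QuantumComplexity Literature.Computability.Complexity

/-- Reindexing the double twisted sum by a coupled pair of bijections: for ANY real weights
`F, G` on `{0,1}ⁿ` and bijections `e, e'` adjoint for the characters
(`twist (e' u) (e v) = twist u v`),
`Σ_x Σ_y F(e' x) · twist x y · G(e y) = Σ_x Σ_y F x · twist x y · G y`. -/
private theorem stub_coupledInvariance_sum_reindex {n : ℕ} (F G : (Fin n → Bool) → ℝ)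
    (e e' : (Fin n → Bool) ≃ (Fin n → Bool)) (hadj : ∀ u v, twist (e' u) (e v) = twist u v) :
    (∑ x : Fin n → Bool, ∑ y : Fin n → Bool, F (e' x) * twist x y * G (e y)) =
      ∑ x : Fin n → Bool, ∑ y : Fin n → Bool, F x * twist x y * G y := by
  rw [← Equiv.sum_comp e' (fun x => ∑ y : Fin n → Bool, F x * twist x y * G y)]
  refine Finset.sum_congr rfl fun x _ => ?_
  rw [← Equiv.sum_comp e (fun y => F (e' x) * twist (e' x) y * G y)]
  refine Finset.sum_congr rfl fun y _ => ?_
  rw [hadj x y]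

/-- COUPLED INVARIANCE (stub `stub_coupledInvariance` of line `Sketch`, crux
stmt-QuantumAdvantage-13931). If the bijections `e, e'` of `{0,1}ⁿ` are adjoint for the
characters, `(-1)^{e'(u)·e(v)} = (-1)^{u·v}` for all `u v` (i.e. `twist (e' u) (e v) = twist u v`),
then the coupled change of coordinates preserves the forrelation exactly, sign included:
`Φ(a ∘ e', b ∘ e) = Φ(a, b)`. Proof: the normalisations agree; reindex the outer sum by `e'`
and the inner by `e` (`Equiv.sum_comp`) and use adjointness on the twist. -/
theorem stub_coupledInvariance :
    ∀ (n : ℕ) (a b : (Fin n → Bool) → Bool) (e e' : (Fin n → Bool) ≃ (Fin n → Bool)),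
      (∀ u v, twist (e' u) (e v) = twist u v) →
      forrelation (fun x => a (e' x)) (fun y => b (e y)) = forrelation a b := by
  intro n a b e e' hadj
  unfold forrelation
  congr 1
  exact stub_coupledInvariance_sum_reindex (fun x => signOf (a x)) (fun y => signOf (b y))
    e e' hadj

/-- The adjointness hypothesis is symmetric in the roles of `e` and `e'`: if
`twist (e' u) (e v) = twist u v` for all `u v`, then `twist (e u) (e' v) = twist u v` for all
`u v` (by `twist_comm`). -/
theorem stub_coupledInvariance_adjoint_symm {n : ℕ} {e e' : (Fin n → Bool) ≃ (Fin n → Bool)}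
    (hadj : ∀ u v, twist (e' u) (e v) = twist u v) :
    ∀ u v, twist (e u) (e' v) = twist u v := by
  intro u v
  rw [twist_comm (e u) (e' v), hadj v u, twist_comm v u]

/-- Mirror form of COUPLED INVARIANCE: under the same adjointness hypothesis
`twist (e' u) (e v) = twist u v`, also `Φ(a ∘ e, b ∘ e') = Φ(a, b)` (swap the roles of `e, e'`
via `stub_coupledInvariance_adjoint_symm`). -/
theorem stub_coupledInvariance_symm :
    ∀ (n : ℕ) (a b : (Fin n → Bool) → Bool) (e e' : (Fin n → Bool) ≃ (Fin n → Bool)),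
      (∀ u v, twist (e' u) (e v) = twist u v) →
      forrelation (fun x => a (e x)) (fun y => b (e' y)) = forrelation a b := by
  intro n a b e e' hadj
  exact stub_coupledInvariance n a b e' e (stub_coupledInvariance_adjoint_symm hadj)

/-- Inverse form of COUPLED INVARIANCE: under the adjointness hypothesis
`twist (e' u) (e v) = twist u v`, the inverse pair `(e⁻¹, e'⁻¹)` is adjoint as well, so
`Φ(a ∘ e'⁻¹, b ∘ e⁻¹) = Φ(a, b)`; equivalently `Φ(a, b) = Φ(a ∘ e', b ∘ e)` read backwards
(undoing the change of coordinates). -/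
theorem stub_coupledInvariance_inv :
    ∀ (n : ℕ) (a b : (Fin n → Bool) → Bool) (e e' : (Fin n → Bool) ≃ (Fin n → Bool)),
      (∀ u v, twist (e' u) (e v) = twist u v) →
      forrelation (fun x => a (e'.symm x)) (fun y => b (e.symm y)) = forrelation a b := by
  intro n a b e e' hadj
  refine stub_coupledInvariance n a b e.symm e'.symm fun u v => ?_
  have h := hadj (e'.symm u) (e.symm v)
  rw [Equiv.apply_symm_apply, Equiv.apply_symm_apply] at h
  exact h.symm

end Summit.QuantumAdvantage.QuantumAdvantage.Theorems.SignedCubicForrelationNotPrBPP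

end
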